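import Literature.GroupTheory.ArithmeticGroups.SL2PrimePowTopLayer
import HarnessLib

/-!
# The two top congruence layers of `SL₂(ℤ/2^e)` (matrix calculus in hypothesis form)

For `e ≥ 4` put `a = 2^{e-2} ∈ R = ℤ/2^e`; then `a² = 0`, `4a = 0` and `2a = ϖ = 2^{e-1}`.  The kernel
`U₂ = ker(SL₂(ℤ/2^e) → SL₂(ℤ/2^{e-2}))` consists of the matrices `1 + aX` (`tr X ≡ 0 mod 4`); it is abelian,
`(1 + aX)(1 + aY) = 1 + a(X + Y)`, isomorphic to `(ℤ/4)³`, and generated by `T̄^a = (1 a; 0 1)`,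
`L̄^a = (1 0; a 1)` and `X̄_a := T̄ L̄^a T̄⁻¹ = (1+a -a; a 1-a)`; its squares form the top layer `1 + ϖ𝔰𝔩₂(𝔽₂)`.
This file records, in hypothesis form (no definitions), the identities in `SL₂(R)` for a commutative ring `R`
and an element `a` with `a² = 0` (and `4a = 0` where needed) that drive the `2`-adic descent step for the Schur
multiplier of `SL₂(ℤ/2^e)` (`SL2TwoPowCentralExtension`, `SL2TwoPowSchurMultiplier`): powers and products of
the three generators, the conjugation identities `T̄ L̄^a T̄⁻¹ = X̄_a`, `L̄ T̄^a L̄⁻¹ = X̄_a⁻¹`, the relation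
`[T̄^a, L̄⁴] = 1`, and the structure / parity lemmas for `U₂ ⊂ SL₂(ℤ/2^e)`.  These are the `p = 2` analogues of
`SL2PrimePowTopLayer` ([CalegariDimitrovTang2025, §4.5, proof of Lemma 4.5.9: `G(4)` is `2`-powerful,
`H²(G(4)) → H²(G(8))` vanishes]; [Beyl1986]).
-/

open scoped MatrixGroups
open Matrix Matrix.SpecialLinearGroup

namespace Literature.GroupTheory.ArithmeticGroups

namespace SL2DoubleLayer

section anyring

variable {R : Type*} [CommRing R] (a : R)
variable (T L Ta La Xa : SL(2, R))

/-- `T̄ L̄_a T̄⁻¹ = X̄_a := (1+a -a; a 1-a)` for `L̄_a = (1 0; a 1)` (exact, no hypothesis on `a`).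
[cite: CalegariDimitrovTang2025, §4.5, proof of Lemma 4.5.9] -/
theorem tBar_conj_la (hT : (T : Matrix (Fin 2) (Fin 2) R) = !![1, 1; 0, 1])
    (hLa : (La : Matrix (Fin 2) (Fin 2) R) = !![1, 0; a, 1]) :
    ((T * La * T⁻¹ : SL(2, R)) : Matrix (Fin 2) (Fin 2) R) = !![1 + a, -a; a, 1 - a] := by
  ext i j; fin_cases i <;> fin_cases j <;>
    simp [hT, hLa, Matrix.mul_apply, Fin.sum_univ_two, Matrix.SpecialLinearGroup.coe_inv,
      Matrix.adjugate_fin_two]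
  all_goals ring

/-- `L̄ T̄_a L̄⁻¹ = (1-a a; -a 1+a)` for `T̄_a = (1 a; 0 1)` (exact). [cite: CalegariDimitrovTang2025, §4.5,
proof of Lemma 4.5.9] -/
theorem lBar_conj_ta (hL : (L : Matrix (Fin 2) (Fin 2) R) = !![1, 0; 1, 1])
    (hTa : (Ta : Matrix (Fin 2) (Fin 2) R) = !![1, a; 0, 1]) :
    ((L * Ta * L⁻¹ : SL(2, R)) : Matrix (Fin 2) (Fin 2) R) = !![1 - a, a; -a, 1 + a] := by
  ext i j; fin_cases i <;> fin_cases j <;>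
    simp [hL, hTa, Matrix.mul_apply, Fin.sum_univ_two, Matrix.SpecialLinearGroup.coe_inv,
      Matrix.adjugate_fin_two]
  all_goals ring

/-- `(L̄ T̄_a L̄⁻¹) · X̄_a = 1`: the two conjugates `L̄ T̄_a L̄⁻¹` and `T̄ L̄_a T̄⁻¹` are mutually inverse
(exact: `(1 - aM)(1 + aM) = 1` for the nilpotent `M = (1 -1; 1 -1)`). [cite: CalegariDimitrovTang2025, §4.5,
proof of Lemma 4.5.9] -/
theorem lBar_conj_ta_mul_xa (hL : (L : Matrix (Fin 2) (Fin 2) R) = !![1, 0; 1, 1])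
    (hTa : (Ta : Matrix (Fin 2) (Fin 2) R) = !![1, a; 0, 1])
    (hXa : (Xa : Matrix (Fin 2) (Fin 2) R) = !![1 + a, -a; a, 1 - a]) :
    L * Ta * L⁻¹ * Xa = 1 := by
  ext i j
  have h := lBar_conj_ta a L Ta hL hTa
  rw [coe_mul, h, hXa]
  fin_cases i <;> fin_cases j <;> simp [Matrix.mul_apply, Fin.sum_univ_two]
  all_goals ring

/-- Powers of `X̄_a`: `X̄_aⁿ = (1+na -na; na 1-na)` (exact: `X̄_a - 1` squares to `0`). [cite: CalegariDimitrovTang2025, §4.5, proof of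
Lemma 4.5.9] -/
theorem xa_pow (hXa : (Xa : Matrix (Fin 2) (Fin 2) R) = !![1 + a, -a; a, 1 - a]) (n : ℕ) :
    ((Xa ^ n : SL(2, R)) : Matrix (Fin 2) (Fin 2) R) = !![1 + (n : R) * a, -((n : R) * a); (n : R) * a, 1 - (n : R) * a] := by
  induction n with
  | zero => ext i j; fin_cases i <;> fin_cases j <;> simp
  | succ n ih =>
    rw [pow_succ, coe_mul, ih, hXa]
    ext i j; fin_cases i <;> fin_cases j <;> simp [Matrix.mul_apply, Fin.sum_univ_two] <;> grind

/-- `T̄_a^i L̄_a^j X̄_a^k = (1+ka (i-k)a; (j+k)a 1-ka)` when `a² = 0`: the additive structure of the double layer.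
[cite: CalegariDimitrovTang2025, §4.5, proof of Lemma 4.5.9] -/
theorem ta_pow_mul_la_pow_mul_xa_pow (ha : a * a = 0) (hTa : (Ta : Matrix (Fin 2) (Fin 2) R) = !![1, a; 0, 1])
    (hLa : (La : Matrix (Fin 2) (Fin 2) R) = !![1, 0; a, 1])
    (hXa : (Xa : Matrix (Fin 2) (Fin 2) R) = !![1 + a, -a; a, 1 - a]) (i j k : ℕ) :
    ((Ta ^ i * La ^ j * Xa ^ k : SL(2, R)) : Matrix (Fin 2) (Fin 2) R) =
      !![1 + (k : R) * a, ((i : R) - k) * a; ((j : R) + k) * a, 1 - (k : R) * a] := by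
  rw [coe_mul, coe_mul, SL2TopLayer.eBar_pow a Ta hTa, SL2TopLayer.fBar_pow a La hLa, xa_pow a Xa hXa]
  ext i' j'; fin_cases i' <;> fin_cases j' <;> simp [Matrix.mul_apply, Fin.sum_univ_two] <;> grind

/-- `[T̄_a, L̄⁴] = 1` when `a² = 0` and `4a = 0`. [cite: CalegariDimitrovTang2025, §4.5, proof of Lemma 4.5.9] -/
theorem ta_comm_lBar_pow_four (ha4 : 4 * a = 0) (hL : (L : Matrix (Fin 2) (Fin 2) R) = !![1, 0; 1, 1])
    (hTa : (Ta : Matrix (Fin 2) (Fin 2) R) = !![1, a; 0, 1]) :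
    Ta * L ^ 4 * Ta⁻¹ * (L ^ 4)⁻¹ = 1 := by
  have hL4 := SL2TopLayer.lBar_pow L hL 4
  have ha4' : a * 4 = 0 := by rw [mul_comm]; exact ha4
  ext i j; fin_cases i <;> fin_cases j <;>
    simp [hL4, hTa, Matrix.mul_apply, Fin.sum_univ_two, Matrix.SpecialLinearGroup.coe_inv,
      Matrix.adjugate_fin_two] <;> grind

/-- `X̄_a² · T̄_a² · (L̄_a²)⁻¹ = (1+2a 0; 0 1-2a)` when `a² = 0`: a lift of the diagonal generator of the top
layer `1 + ϖ𝔰𝔩₂`, `ϖ = 2a`. [cite: CalegariDimitrovTang2025, §4.5, proof of Lemma 4.5.9] -/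
theorem xa_sq_mul_ta_sq_mul_la_sq_inv (ha : a * a = 0) (hTa : (Ta : Matrix (Fin 2) (Fin 2) R) = !![1, a; 0, 1])
    (hLa : (La : Matrix (Fin 2) (Fin 2) R) = !![1, 0; a, 1])
    (hXa : (Xa : Matrix (Fin 2) (Fin 2) R) = !![1 + a, -a; a, 1 - a]) :
    ((Xa ^ 2 * Ta ^ 2 * (La ^ 2)⁻¹ : SL(2, R)) : Matrix (Fin 2) (Fin 2) R) =
      !![1 + 2 * a, 0; 0, 1 - 2 * a] := by
  rw [coe_mul, coe_mul, Matrix.SpecialLinearGroup.coe_inv, xa_pow a Xa hXa, SL2TopLayer.eBar_pow a Ta hTa,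
    SL2TopLayer.fBar_pow a La hLa]
  ext i j; fin_cases i <;> fin_cases j <;>
    simp [Matrix.mul_apply, Fin.sum_univ_two, Matrix.adjugate_fin_two] <;> grind

end anyring

section zmod

variable (e : ℕ)

/-- `a² = 0` in `ℤ/2^e` for `a = 2^{e-2}` and `e ≥ 4`. [cite: CalegariDimitrovTang2025, §4.5, proof of Lemma
4.5.9] -/
theorem a_mul_a (he : 4 ≤ e) :
    (2 : ZMod (2 ^ e)) ^ (e - 2) * (2 : ZMod (2 ^ e)) ^ (e - 2) = 0 := by
  have h : ((2 ^ (e - 2) * 2 ^ (e - 2) : ℕ) : ZMod (2 ^ e)) = 0 := by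
    rw [ZMod.natCast_eq_zero_iff, ← pow_add]
    exact pow_dvd_pow 2 (by omega)
  exact_mod_cast h

/-- `4a = 0` in `ℤ/2^e` for `a = 2^{e-2}`, `e ≥ 2`. [cite: CalegariDimitrovTang2025, §4.5, proof of Lemma
4.5.9] -/
theorem four_mul_a (he : 2 ≤ e) : (4 : ZMod (2 ^ e)) * (2 : ZMod (2 ^ e)) ^ (e - 2) = 0 := by
  have h : ((2 ^ 2 * 2 ^ (e - 2) : ℕ) : ZMod (2 ^ e)) = 0 := by
    rw [ZMod.natCast_eq_zero_iff, ← pow_add]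
    exact pow_dvd_pow 2 (by omega)
  have h4 : (4 : ZMod (2 ^ e)) = 2 ^ 2 := by norm_num
  rw [h4]
  exact_mod_cast h

/-- `2a = ϖ`: `2 · 2^{e-2} = 2^{e-1}` in `ℤ/2^e` (`e ≥ 2`). [cite: CalegariDimitrovTang2025, §4.5, proof of
Lemma 4.5.9] -/
theorem two_mul_a (he : 2 ≤ e) :
    (2 : ZMod (2 ^ e)) * (2 : ZMod (2 ^ e)) ^ (e - 2) = (2 : ZMod (2 ^ e)) ^ (e - 1) := by
  rw [← pow_succ', show e - 2 + 1 = e - 1 by omega]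

/-- `(2n) a = n ϖ` with `ϖ = 2^{e-1}`. [cite: CalegariDimitrovTang2025, §4.5, proof of Lemma 4.5.9] -/
theorem two_mul_natCast_mul_a (he : 2 ≤ e) (n : ℕ) :
    2 * (n : ZMod (2 ^ e)) * (2 : ZMod (2 ^ e)) ^ (e - 2) = (n : ZMod (2 ^ e)) * (2 : ZMod (2 ^ e)) ^ (e - 1) := by
  rw [← two_mul_a e he]
  ring

/-- An element of `ℤ/2^e` reducing to `0` in `ℤ/2^{e-2}` is a multiple of `a = 2^{e-2}`. [cite:
CalegariDimitrovTang2025, §4.5, proof of Lemma 4.5.9] -/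
theorem exists_eq_mul_a {x : ZMod (2 ^ e)}
    (hx : ZMod.castHom (pow_dvd_pow 2 (Nat.sub_le e 2)) (ZMod (2 ^ (e - 2))) x = 0) :
    ∃ y : ZMod (2 ^ e), x = y * (2 : ZMod (2 ^ e)) ^ (e - 2) := by
  haveI : NeZero (2 ^ e) := ⟨pow_ne_zero _ two_ne_zero⟩
  rw [ZMod.castHom_apply, ZMod.cast_eq_val, ZMod.natCast_eq_zero_iff] at hx
  obtain ⟨k, hk⟩ := hx
  refine ⟨k, ?_⟩
  rw [← ZMod.natCast_zmod_val x, hk, Nat.cast_mul, Nat.cast_pow, Nat.cast_ofNat, mul_comm]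

/-- **Structure of the double layer** (`e ≥ 4`): every `M ∈ SL₂(ℤ/2^e)` with trivial reduction modulo `2^{e-2}`
is `T̄_a^i L̄_a^j X̄_a^k` for some `i, j, k ∈ ℕ`. [cite: CalegariDimitrovTang2025, §4.5, proof of Lemma 4.5.9] -/
theorem exists_eq_pow_mul_pow_mul_pow₂ (he : 4 ≤ e) (Ta La Xa : SL(2, ZMod (2 ^ e)))
    (hTa : (Ta : Matrix (Fin 2) (Fin 2) (ZMod (2 ^ e))) = !![1, (2 : ZMod (2 ^ e)) ^ (e - 2); 0, 1])
    (hLa : (La : Matrix (Fin 2) (Fin 2) (ZMod (2 ^ e))) = !![1, 0; (2 : ZMod (2 ^ e)) ^ (e - 2), 1])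
    (hXa : (Xa : Matrix (Fin 2) (Fin 2) (ZMod (2 ^ e))) =
      !![1 + (2 : ZMod (2 ^ e)) ^ (e - 2), -(2 : ZMod (2 ^ e)) ^ (e - 2);
         (2 : ZMod (2 ^ e)) ^ (e - 2), 1 - (2 : ZMod (2 ^ e)) ^ (e - 2)])
    {M : SL(2, ZMod (2 ^ e))}
    (hM : Matrix.SpecialLinearGroup.map (ZMod.castHom (pow_dvd_pow 2 (Nat.sub_le e 2)) (ZMod (2 ^ (e - 2)))) M = 1) :
    ∃ i j k : ℕ, M = Ta ^ i * La ^ j * Xa ^ k := by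
  set a : ZMod (2 ^ e) := (2 : ZMod (2 ^ e)) ^ (e - 2) with hadef
  have ha : a * a = 0 := a_mul_a e he
  have hent : ∀ i j, ZMod.castHom (pow_dvd_pow 2 (Nat.sub_le e 2)) (ZMod (2 ^ (e - 2))) (M i j) =
      (1 : Matrix (Fin 2) (Fin 2) (ZMod (2 ^ (e - 2)))) i j := fun i j ↦ by
    have := congr_arg (fun N : SL(2, ZMod (2 ^ (e - 2))) ↦ N i j) hM
    simpa [-ZMod.castHom_apply] using this
  have h00 : ZMod.castHom (pow_dvd_pow 2 (Nat.sub_le e 2)) (ZMod (2 ^ (e - 2))) (M 0 0 - 1) = 0 := by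
    rw [map_sub, hent, map_one]; simp
  have h01 : ZMod.castHom (pow_dvd_pow 2 (Nat.sub_le e 2)) (ZMod (2 ^ (e - 2))) (M 0 1) = 0 := by
    rw [hent]; simp
  have h10 : ZMod.castHom (pow_dvd_pow 2 (Nat.sub_le e 2)) (ZMod (2 ^ (e - 2))) (M 1 0) = 0 := by
    rw [hent]; simp
  have h11 : ZMod.castHom (pow_dvd_pow 2 (Nat.sub_le e 2)) (ZMod (2 ^ (e - 2))) (M 1 1 - 1) = 0 := by
    rw [map_sub, hent, map_one]; simp
  obtain ⟨x00, hx00⟩ := exists_eq_mul_a e h00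
  obtain ⟨x01, hx01⟩ := exists_eq_mul_a e h01
  obtain ⟨x10, hx10⟩ := exists_eq_mul_a e h10
  obtain ⟨x11, hx11⟩ := exists_eq_mul_a e h11
  have hM00 : M 0 0 = 1 + x00 * a := by rw [← hx00]; ring
  have hM11 : M 1 1 = 1 + x11 * a := by rw [← hx11]; ring
  -- det M = 1 forces (x00 + x11) a = 0
  have hdet : M 0 0 * M 1 1 - M 0 1 * M 1 0 = 1 := by
    have := M.2; rw [Matrix.det_fin_two] at this; exact this
  have htr : x11 * a = -(x00 * a) := by
    rw [hM00, hM11, hx01, hx10] at hdet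
    have h2 : (1 + x00 * a) * (1 + x11 * a) - x01 * a * (x10 * a) = 1 + x00 * a + x11 * a := by
      have h3 : x00 * a * (x11 * a) = 0 := by
        rw [show x00 * a * (x11 * a) = x00 * x11 * (a * a) by ring, ha, mul_zero]
      have h4 : x01 * a * (x10 * a) = 0 := by
        rw [show x01 * a * (x10 * a) = x01 * x10 * (a * a) by ring, ha, mul_zero]
      rw [h4, sub_zero, show (1 + x00 * a) * (1 + x11 * a) = 1 + x00 * a + x11 * a + x00 * a * (x11 * a) by ring,
        h3, add_zero]
    rw [h2] at hdet
    have : x00 * a + x11 * a = 0 := by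
      have h5 := sub_eq_zero.mpr hdet.symm
      rw [show 1 - (1 + x00 * a + x11 * a) = -(x00 * a + x11 * a) by ring, neg_eq_zero] at h5
      exact h5
    rw [eq_neg_iff_add_eq_zero, add_comm]; exact this
  haveI : NeZero (2 ^ e) := ⟨pow_ne_zero _ two_ne_zero⟩
  refine ⟨(x01 + x00).val, (x10 - x00).val, x00.val, ?_⟩
  apply Subtype.ext
  rw [ta_pow_mul_la_pow_mul_xa_pow a Ta La Xa ha hTa hLa hXa]
  simp only [ZMod.natCast_val, ZMod.cast_id', id_eq]
  ext i j; fin_cases i <;> fin_cases j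
  · simp [hM00]
  · simp [hx01]; ring
  · simp [hx10]; ring
  · simp [hM11, htr]; ring

/-- **Parity in the double layer**: if `T̄_a^{2i} L̄_a^{2j} X̄_a^{2k} = 1` in `SL₂(ℤ/2^e)` (`e ≥ 4`) then `i, j, k`
are even. [cite: CalegariDimitrovTang2025, §4.5, proof of Lemma 4.5.9] -/
theorem even_of_pow_mul_pow_mul_pow_eq_one (he : 4 ≤ e) (Ta La Xa : SL(2, ZMod (2 ^ e)))
    (hTa : (Ta : Matrix (Fin 2) (Fin 2) (ZMod (2 ^ e))) = !![1, (2 : ZMod (2 ^ e)) ^ (e - 2); 0, 1])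
    (hLa : (La : Matrix (Fin 2) (Fin 2) (ZMod (2 ^ e))) = !![1, 0; (2 : ZMod (2 ^ e)) ^ (e - 2), 1])
    (hXa : (Xa : Matrix (Fin 2) (Fin 2) (ZMod (2 ^ e))) =
      !![1 + (2 : ZMod (2 ^ e)) ^ (e - 2), -(2 : ZMod (2 ^ e)) ^ (e - 2);
         (2 : ZMod (2 ^ e)) ^ (e - 2), 1 - (2 : ZMod (2 ^ e)) ^ (e - 2)])
    {i j k : ℕ} (h : Ta ^ (2 * i) * La ^ (2 * j) * Xa ^ (2 * k) = 1) : 2 ∣ i ∧ 2 ∣ j ∧ 2 ∣ k := by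
  set a : ZMod (2 ^ e) := (2 : ZMod (2 ^ e)) ^ (e - 2) with hadef
  have ha : a * a = 0 := a_mul_a e he
  have he2 : 2 ≤ e := by omega
  have he1 : 1 ≤ e := by omega
  have hcoe := ta_pow_mul_la_pow_mul_xa_pow a Ta La Xa ha hTa hLa hXa (2 * i) (2 * j) (2 * k)
  rw [h] at hcoe
  have hk0 : 2 * (k : ZMod (2 ^ e)) * a = 0 := by
    have h2 := congr_arg (fun N : Matrix (Fin 2) (Fin 2) (ZMod (2 ^ e)) ↦ N 0 0) hcoe
    simp at h2
    linear_combination h2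
  have hi0 : 2 * (i : ZMod (2 ^ e)) * a = 0 := by
    have h2 := congr_arg (fun N : Matrix (Fin 2) (Fin 2) (ZMod (2 ^ e)) ↦ N 0 1) hcoe
    simp at h2
    linear_combination (-1 : ZMod (2 ^ e)) * h2 + hk0
  have hj0 : 2 * (j : ZMod (2 ^ e)) * a = 0 := by
    have h2 := congr_arg (fun N : Matrix (Fin 2) (Fin 2) (ZMod (2 ^ e)) ↦ N 1 0) hcoe
    simp at h2
    linear_combination (-1 : ZMod (2 ^ e)) * h2 - hk0
  rw [two_mul_natCast_mul_a e he2] at hk0 hi0 hj0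
  have hϖ : ∀ n : ℕ, (n : ZMod (2 ^ e)) * (2 : ZMod (2 ^ e)) ^ (e - 1) = 0 → 2 ∣ n := by
    intro n hn
    have h := (SL2TopLayer.natCast_mul_varpi_eq_zero_iff 2 e Nat.prime_two he1 n)
    rw [Nat.cast_ofNat] at h
    exact h.mp hn
  exact ⟨hϖ i hi0, hϖ j hj0, hϖ k hk0⟩

/-- Squares of the double layer lie in the top layer: `T̄_a^{2i} L̄_a^{2j} X̄_a^{2k}` reduces to `1` modulo
`2^{e-1}`. [cite: CalegariDimitrovTang2025, §4.5, proof of Lemma 4.5.9] -/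
theorem map_castHom_pow_mul_pow_mul_pow_eq_one (he : 4 ≤ e) (Ta La Xa : SL(2, ZMod (2 ^ e)))
    (hTa : (Ta : Matrix (Fin 2) (Fin 2) (ZMod (2 ^ e))) = !![1, (2 : ZMod (2 ^ e)) ^ (e - 2); 0, 1])
    (hLa : (La : Matrix (Fin 2) (Fin 2) (ZMod (2 ^ e))) = !![1, 0; (2 : ZMod (2 ^ e)) ^ (e - 2), 1])
    (hXa : (Xa : Matrix (Fin 2) (Fin 2) (ZMod (2 ^ e))) =
      !![1 + (2 : ZMod (2 ^ e)) ^ (e - 2), -(2 : ZMod (2 ^ e)) ^ (e - 2);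
         (2 : ZMod (2 ^ e)) ^ (e - 2), 1 - (2 : ZMod (2 ^ e)) ^ (e - 2)])
    (i j k : ℕ) :
    Matrix.SpecialLinearGroup.map (ZMod.castHom (pow_dvd_pow 2 (Nat.sub_le e 1)) (ZMod (2 ^ (e - 1))))
      (Ta ^ (2 * i) * La ^ (2 * j) * Xa ^ (2 * k)) = 1 := by
  set a : ZMod (2 ^ e) := (2 : ZMod (2 ^ e)) ^ (e - 2) with hadef
  have ha : a * a = 0 := a_mul_a e he
  have he2 : 2 ≤ e := by omega
  have hcoe := ta_pow_mul_la_pow_mul_xa_pow a Ta La Xa ha hTa hLa hXa (2 * i) (2 * j) (2 * k)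
  have key := SL2TopLayer.map_castHom_eq_one_of_coe 2 e (Ta ^ (2 * i) * La ^ (2 * j) * Xa ^ (2 * k))
    (x00 := k) (x01 := (i : ZMod (2 ^ e)) - k) (x10 := (j : ZMod (2 ^ e)) + k) (x11 := -(k : ZMod (2 ^ e)))
  simp only [Nat.cast_ofNat] at key
  apply key
  rw [hcoe, ← two_mul_a e he2]
  ext i' j'; fin_cases i' <;> fin_cases j' <;> simp <;> ring

end zmod

end SL2DoubleLayer

end Literature.GroupTheory.ArithmeticGroups
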